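import Mathlib
import Literature.Probability.LatticeModels.ScalingLimit
import Summits.CriticalPhenomena.Ising3DConformalLimit.Theorems.PrimaryAtInfinityMultipoleToWardHelpers
import HarnessLib

/-!
# Helpers for stub S5b `stub_multipoleToWardOfContinuous` (line `multipole-ward-nonsat-endpoint`,
crux `MoebiusLimitOfTwoPointLaw`, item stmt-CriticalPhenomena-4801), part 1

Elementary analysis on `(ℝ³)ⁿ⁺¹ = (ℝ³)ⁿ × ℝ³` used to pass from the first-multipole identity of the
`(n+2)`-point function to the weak special-conformal Ward identity of the `n`-point function
(item stmt-CriticalPhenomena-5356 `PrimaryAtInfinity.MultipoleToWard`, here with continuous far-field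
coefficients). Generic lemmas already available in
`Theorems/PrimaryAtInfinityMultipoleToWardHelpers.lean` (odd integrals, dilations, Fubini through the
last point, tensor test functions) are imported and reused, not restated. New here:

* `mtw_integral_init_mul_last` (registered sub-goal), `mtw_integrable_init_mul_last`: separation of
  variables `∫ F(init w) G(w last) dw = (∫ F)(∫ G)` directly on `(ℝ³)ⁿ⁺¹`;
* `mtw_fderiv_comp_smul`, `mtw_fderiv_neg_of_even`: the derivative of an even function is odd;
* `mtw_fderiv_psi`: the product rule for `ψ(w) = φ(init w) g(w last)` at a general point `w`;
* `mtw_hasCompactSupport_of_vanish`, `mtw_setOf_subset_nonCoincident`: support bookkeeping for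
  functions vanishing unless `init w ∈ tsupport φ` and `w last ∈ tsupport g`;
* `mtw_tsupport_norm_bounds`, `mtw_exists_dominatingBump`: radii of an annular cut-off and a
  dominating bump.

THEOREM-ONLY file (no definitions). [folklore; Hörmander, *ALPDO I*, §1]
-/

noncomputable section

namespace Summit.CriticalPhenomena.Ising3DConformalLimit.PrecisionLaplacianMoebiusLimitOfTwoPointLaw

open Literature.Probability.LatticeModels Filter Topology MeasureTheory
open Summit.CriticalPhenomena.Ising3DConformalLimit.Theorems.PrimaryAtInfinityMultipoleToWard

/-! ## Product structure `(ℝ³)ⁿ⁺¹ ≃ (ℝ³)ⁿ × ℝ³` -/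

/-- Separation of variables on `(ℝ³)ⁿ⁺¹ = (ℝ³)ⁿ × ℝ³` (last coordinate split off):
`∫ F(init w) G(w last) dw = (∫ F)(∫ G)`, with no integrability hypotheses (registered sub-goal of
stub `stub_multipoleToWardOfContinuous`). -/
theorem mtw_integral_init_mul_last :
    ∀ (n : ℕ) (F : (Fin n → EuclideanSpace ℝ (Fin 3)) → ℝ) (G : EuclideanSpace ℝ (Fin 3) → ℝ),
      ∫ w : Fin (n + 1) → EuclideanSpace ℝ (Fin 3), F (Fin.init w) * G (w (Fin.last n)) =
        (∫ x, F x) * ∫ z, G z := by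
  intro n F G
  rw [integral_comp_snoc (fun w : Fin (n + 1) → EuclideanSpace ℝ (Fin 3) =>
    F (Fin.init w) * G (w (Fin.last n)))]
  simp only [Fin.init_snoc, Fin.snoc_last]
  rw [mul_comm, ← integral_fst_mul_snd G F]
  simp only [mul_comm]

/-- Integrability of a separated product `F(init w) G(w last)` on `(ℝ³)ⁿ⁺¹`. -/
theorem mtw_integrable_init_mul_last {n : ℕ} {F : (Fin n → EuclideanSpace ℝ (Fin 3)) → ℝ}
    {G : EuclideanSpace ℝ (Fin 3) → ℝ} (hF : Integrable F) (hG : Integrable G) :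
    Integrable
      (fun w : Fin (n + 1) → EuclideanSpace ℝ (Fin 3) => F (Fin.init w) * G (w (Fin.last n))) := by
  have he := volume_preserving_piFinSuccAbove (fun _ : Fin (n + 1) => EuclideanSpace ℝ (Fin 3))
    (Fin.last n)
  have h : Integrable (fun p : EuclideanSpace ℝ (Fin 3) × (Fin n → EuclideanSpace ℝ (Fin 3)) =>
      G p.1 * F p.2) ((volume : Measure (EuclideanSpace ℝ (Fin 3))).prod volume) := hG.mul_prod hF
  have h2 := he.integrable_comp_of_integrable (g := fun p => G p.1 * F p.2)
    (by rw [← Measure.volume_eq_prod] at h; exact h)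
  refine h2.congr (ae_of_all _ fun w => ?_)
  simp only [Function.comp_apply, MeasurableEquiv.piFinSuccAbove_apply, Fin.insertNthEquiv,
    Equiv.coe_fn_symm_mk, Fin.removeNth_last, mul_comm]

/-! ## Derivatives of even functions and of dilates -/

/-- Chain rule through a homothety: `D(χ ∘ (a • ·))(z)[u] = Dχ(a • z)[a • u]` (no differentiability
needed, by `fderiv_comp_smul`). -/
theorem mtw_fderiv_comp_smul (χ : EuclideanSpace ℝ (Fin 3) → ℝ) (a : ℝ)
    (z u : EuclideanSpace ℝ (Fin 3)) :
    fderiv ℝ (fun y => χ (a • y)) z u = fderiv ℝ χ (a • z) (a • u) := by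
  rw [fderiv_comp_smul, ContinuousLinearMap.map_smul, smul_eq_mul]
  rfl

/-- The derivative of an even function on `ℝ³` is odd: `Dχ(-z) = -Dχ(z)`. -/
theorem mtw_fderiv_neg_of_even {χ : EuclideanSpace ℝ (Fin 3) → ℝ} (hχ : ∀ z, χ (-z) = χ z)
    (z u : EuclideanSpace ℝ (Fin 3)) : fderiv ℝ χ (-z) u = -fderiv ℝ χ z u := by
  have h : (fun y => χ ((-1 : ℝ) • y)) = χ := funext fun y => by rw [neg_one_smul, hχ]
  have h2 := mtw_fderiv_comp_smul χ (-1) (-z) u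
  rw [h] at h2
  rw [h2, neg_one_smul, neg_neg, neg_one_smul, ContinuousLinearMap.map_neg]

/-! ## The test function `ψ(w) = φ(init w) g(w last)` at a general point -/

/-- Product rule for the test function `ψ(w) = φ(init w) · g(w last)` at an arbitrary point `w`:
`Dψ(w)[U] = g(w last) Dφ(init w)[init U] + φ(init w) Dg(w last)[U last]`. -/
theorem mtw_fderiv_psi {n : ℕ} {φ : (Fin n → EuclideanSpace ℝ (Fin 3)) → ℝ}
    {g : EuclideanSpace ℝ (Fin 3) → ℝ} (hφ : Differentiable ℝ φ) (hg : Differentiable ℝ g)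
    (w U : Fin (n + 1) → EuclideanSpace ℝ (Fin 3)) :
    fderiv ℝ (fun w : Fin (n + 1) → EuclideanSpace ℝ (Fin 3) => φ (Fin.init w) * g (w (Fin.last n)))
        w U =
      g (w (Fin.last n)) * fderiv ℝ φ (Fin.init w) (Fin.init U) +
        φ (Fin.init w) * fderiv ℝ g (w (Fin.last n)) (U (Fin.last n)) := by
  have h := fderiv_init_mul_last_apply hφ hg (Fin.init w) (w (Fin.last n)) U
  rwa [Fin.snoc_init_self] at h

/-- Compact support of functions on `(ℝ³)ⁿ⁺¹` vanishing unless `init w ∈ tsupport φ` and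
`w last ∈ tsupport g`: their topological support lies in the compact set
`{w | init w ∈ tsupport φ ∧ w last ∈ tsupport g}`. -/
theorem mtw_hasCompactSupport_of_vanish {n : ℕ} {φ : (Fin n → EuclideanSpace ℝ (Fin 3)) → ℝ}
    {g : EuclideanSpace ℝ (Fin 3) → ℝ} (hφc : HasCompactSupport φ) (hgc : HasCompactSupport g)
    {θ : (Fin (n + 1) → EuclideanSpace ℝ (Fin 3)) → ℝ}
    (h1 : ∀ w : Fin (n + 1) → EuclideanSpace ℝ (Fin 3), Fin.init w ∉ tsupport φ → θ w = 0)
    (h2 : ∀ w : Fin (n + 1) → EuclideanSpace ℝ (Fin 3), w (Fin.last n) ∉ tsupport g → θ w = 0) :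
    HasCompactSupport θ ∧
      tsupport θ ⊆ {w : Fin (n + 1) → EuclideanSpace ℝ (Fin 3) |
        Fin.init w ∈ tsupport φ ∧ w (Fin.last n) ∈ tsupport g} := by
  have hc1 : Continuous fun w : Fin (n + 1) → EuclideanSpace ℝ (Fin 3) =>
      (Fin.init w : Fin n → EuclideanSpace ℝ (Fin 3)) := continuous_id.finInit
  have hc2 : Continuous fun w : Fin (n + 1) → EuclideanSpace ℝ (Fin 3) => w (Fin.last n) :=
    continuous_apply _
  have hclosed : IsClosed {w : Fin (n + 1) → EuclideanSpace ℝ (Fin 3) |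
      Fin.init w ∈ tsupport φ ∧ w (Fin.last n) ∈ tsupport g} := by
    rw [Set.setOf_and]
    exact ((isClosed_tsupport φ).preimage hc1).inter ((isClosed_tsupport g).preimage hc2)
  have hcompact : IsCompact {w : Fin (n + 1) → EuclideanSpace ℝ (Fin 3) |
      Fin.init w ∈ tsupport φ ∧ w (Fin.last n) ∈ tsupport g} := by
    refine ((hgc.isCompact.prod hφc.isCompact).image continuous_snoc_prod).of_isClosed_subset
      hclosed ?_
    intro w hw
    exact ⟨(w (Fin.last n), Fin.init w), ⟨hw.2, hw.1⟩, Fin.snoc_init_self w⟩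
  have hsub : tsupport θ ⊆ {w | Fin.init w ∈ tsupport φ ∧ w (Fin.last n) ∈ tsupport g} := by
    refine closure_minimal (fun w hw => ?_) hclosed
    rw [Function.mem_support] at hw
    exact ⟨by_contra fun h => hw (h1 w h), by_contra fun h => hw (h2 w h)⟩
  exact ⟨hcompact.of_isClosed_subset (isClosed_tsupport θ) hsub, hsub⟩

/-- If `x` is non-coincident and `z` avoids the points of `x`, then `(x, z)` is non-coincident
(set form). -/
theorem mtw_setOf_subset_nonCoincident {n : ℕ} {K : Set (Fin n → EuclideanSpace ℝ (Fin 3))}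
    {T : Set (EuclideanSpace ℝ (Fin 3))} (hK : K ⊆ NonCoincident 3 n)
    (hsep : ∀ x ∈ K, ∀ z ∈ T, ∀ i, x i ≠ z) :
    {w : Fin (n + 1) → EuclideanSpace ℝ (Fin 3) |
        (Fin.init w : Fin n → EuclideanSpace ℝ (Fin 3)) ∈ K ∧ w (Fin.last n) ∈ T} ⊆
      NonCoincident 3 (n + 1) := by
  intro w hw
  rw [mem_nonCoincident, ← Fin.snoc_init_self w, Fin.snoc_injective_iff]
  refine ⟨hK hw.1, ?_⟩
  rintro ⟨i, hi⟩
  exact hsep _ hw.1 _ hw.2 i hi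

/-! ## Radii -/

/-- A compactly supported `χ` vanishing on the closed unit ball has `tsupport χ ⊆ {1 ≤ ‖z‖ ≤ R}`
for some `R ≥ 1`. -/
theorem mtw_tsupport_norm_bounds {χ : EuclideanSpace ℝ (Fin 3) → ℝ} (hχc : HasCompactSupport χ)
    (h1 : ∀ x, ‖x‖ ≤ 1 → χ x = 0) :
    ∃ R : ℝ, 1 ≤ R ∧ ∀ z ∈ tsupport χ, 1 ≤ ‖z‖ ∧ ‖z‖ ≤ R := by
  obtain ⟨R₀, hR₀⟩ := hχc.isCompact.isBounded.exists_norm_le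
  have hsub : Function.support χ ⊆ {z : EuclideanSpace ℝ (Fin 3) | 1 ≤ ‖z‖} := by
    intro z hz
    rw [Function.mem_support] at hz
    by_contra h
    exact hz (h1 z (le_of_lt (not_le.1 h)))
  have hcl : tsupport χ ⊆ {z : EuclideanSpace ℝ (Fin 3) | 1 ≤ ‖z‖} :=
    closure_minimal hsub (isClosed_le continuous_const continuous_norm)
  exact ⟨max R₀ 1, le_max_right _ _, fun z hz => ⟨hcl hz, (hR₀ z hz).trans (le_max_left _ _)⟩⟩

/-- A nonnegative continuous compactly supported function on `ℝ³` equal to `1` on `‖z‖ ≤ R`. -/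
theorem mtw_exists_dominatingBump {R : ℝ} (hR : 0 < R) :
    ∃ d : EuclideanSpace ℝ (Fin 3) → ℝ, Continuous d ∧ HasCompactSupport d ∧ (∀ z, 0 ≤ d z) ∧
      ∀ z, ‖z‖ ≤ R → d z = 1 := by
  let η : ContDiffBump (0 : EuclideanSpace ℝ (Fin 3)) := ⟨R, R + 1, hR, by linarith⟩
  refine ⟨η, η.continuous, η.hasCompactSupport, fun z => η.nonneg, fun z hz => ?_⟩
  exact η.one_of_mem_closedBall (by rw [Metric.mem_closedBall, dist_zero_right]; exact hz)

end Summit.CriticalPhenomena.Ising3DConformalLimit.PrecisionLaplacianMoebiusLimitOfTwoPointLaw
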